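import Literature.Topology.FourManifolds.FreedmanApproximation
import Mathlib.Topology.Compactification.OnePoint.Sphere
import Mathlib.Topology.Maps.Proper.CompactlyGenerated

/-!
# Freedman's approximation theorem for proper self-maps of `ℝⁿ` (the last step of the proof of
# Thm. 1.1 of Freedman 1982)

Topic `Literature/Topology/FourManifolds` (fact seat
`provefact-Literature.Topology.FourManifolds.nonempty_homeomorph_of_isHCobordant_four`; F3 thread).
**Everything in this file is proved.**

The end of the proof of Freedman's Theorem 1.1 (every Casson handle is homeomorphic as a pair to
the standard open 2-handle), JDG 1982, pp. 412–413, runs: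

> *Consider the proper map of pairs `β : CH → CH/{gaps⁺}`. Compose with the homeomorphism
> given by Theorem 8.3 to obtain a map of pairs `β̄ : CH → H`. Since `W ∩ {gaps⁺} = ∅`, `β̄|W` is
> a homeomorphism and `β̄⁻¹β̄(W) = W`. Delete the attaching regions and then form the 1-point
> compactifications (denoted by `∪ ∞`) of both domain and range. From `β̄` we obtain a map
> `f : S⁴ → S⁴` between the 1-point compactifications of spaces homeomorphic to `R⁴`. We verify
> that `f` satisfies the hypotheses of Theorem 9.1* [only finitely many gaps have diameter larger
> than any fixed `ε > 0`; the singular set is nowhere dense] *[...] Apply Theorem 9.1 to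
> conclude `f` is ABH. Let `C` denote the image under 1-point compactification of the half open
> collar [...]. Our observation that `f` is a homeomorphism over `f(W)` now implies that `f|_C`
> is a homeomorphism onto its image (and that `f⁻¹(f(C)) = C`). Thus setting `f(C) = C` we can
> apply Corollary 7.1 to find a homeomorphism `h : S⁴ → S⁴` with `h|_C = f|_C`. In particular
> `h(∞) = ∞`. Now remove the compactification point `∞` from source and target 4-spheres. This
> yields `h| : CH ∖ ∂⁻CH → H ∖ ∂⁻H` which agrees with `f` on a neighborhood of the deleted
> attaching region.*

This file proves the generic content of that paragraph, with Cor. 7.1 replaced by the relative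
form of Thm. 9.1 (Freedman's footnote 13; `FreedmanApproximation.lean`), so that no torus trick
is involved:

* `Literature.Topology.FourManifolds.exists_homeomorph_eqOn_of_isProperMap` — **a proper
  surjective self-map `β` of `ℝⁿ` (`n ≥ 2`) with nowhere dense singular set and null point
  inverses agrees with a self-homeomorphism `h` of `ℝⁿ` on `β⁻¹C`, for any closed set of values
  `C` missing the singular set** (i.e. over which `β` is already one-to-one).  Proof as printed:
  `β` extends to the one-point compactifications (`OnePoint.map β`, continuous because `β` is
  proper), which are topological `n`-spheres (Mathlib's `onePointEquivSphereOfFinrankEq`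
  transports everything to the round sphere `Sⁿ ⊂ ℝⁿ⁺¹`, a compact metric space satisfying the
  tree's `IsTopSphere n`); the extension `f` is surjective, its singular set is the image of
  `S(β)` (the fibre of `∞` is `{∞}`), nowhere dense, its fibres are null for the metric of `Sⁿ`
  because the embedding `ℝⁿ → Sⁿ` is uniformly continuous (it is continuous with a limit at
  infinity, Mathlib's `Continuous.uniformContinuous_of_tendsto_cocompact`), and `f` is
  one-to-one over the closed set
  `C ∪ {∞}`; the relative Thm. 9.1 gives a homeomorphism of `Sⁿ` agreeing with `f` over
  `C ∪ {∞}`, in particular fixing `∞`, and removing `∞` (`Homeomorph.onePointRestrict`) gives `h`.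
* `Literature.Topology.FourManifolds.exists_homeomorph_eqOn_dist_lt_of_isProperMap` — the same
  with, in addition, `h` uniformly close to `β` over any given compact set of values (the
  noncompact remnant of "`f` is ABH").

## References

* M. H. Freedman, *The topology of four-dimensional manifolds*, J. Differential Geom. **17**
  (1982) 357–453, proof of Thm. 1.1 (pp. 412–413), Thm. 9.1 (p. 432), footnote 13 (p. 412),
  Cor. 7.1 (p. 421). [FreedmanJDG1982]
* F. D. Ancel, *Approximating cell-like maps of `S⁴` by homeomorphisms*, in *Four-Manifold
  Theory* (Durham, N.H., 1982), Contemp. Math. **35**, AMS (1984) 143–164, Thm. 1.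
  [Ancel1984]
-/

open Set Function Metric Filter
open scoped Topology OnePoint

noncomputable section

/-! ### §1 Self-homeomorphisms of a one-point compactification fixing `∞` -/

namespace Homeomorph

open OnePoint

variable {X : Type*} [TopologicalSpace X]

/-- A self-homeomorphism of `OnePoint X` fixing `∞` takes finite points to finite points.
[folklore] -/
theorem onePoint_apply_coe_ne_infty (H : OnePoint X ≃ₜ OnePoint X) (hH : H ∞ = ∞) (x : X) :
    H x ≠ ∞ := fun h =>
  OnePoint.coe_ne_infty x (H.injective (h.trans hH.symm))

/-- **Removing the point at infinity**: a self-homeomorphism of the one-point compactification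
`OnePoint X` fixing `∞` restricts to a self-homeomorphism of `X` (Freedman: *"In particular
`h(∞) = ∞`. Now remove the compactification point `∞` from source and target"*).
[cite: FreedmanJDG1982, proof of Thm. 1.1 (p. 413)] -/
def onePointRestrict (H : OnePoint X ≃ₜ OnePoint X) (hH : H ∞ = ∞) : X ≃ₜ X :=
  have hH' : H.symm ∞ = ∞ := by rw [H.symm_apply_eq]; exact hH.symm
  have h1 : ∀ x : X, ∃ y : X, (y : OnePoint X) = H x := fun x =>
    ne_infty_iff_exists.1 (H.onePoint_apply_coe_ne_infty hH x)
  have h2 : ∀ x : X, ∃ y : X, (y : OnePoint X) = H.symm x := fun x =>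
    ne_infty_iff_exists.1 (H.symm.onePoint_apply_coe_ne_infty hH' x)
  { toFun := fun x => (h1 x).choose
    invFun := fun x => (h2 x).choose
    left_inv := fun x => coe_injective (by
      rw [(h2 _).choose_spec, (h1 x).choose_spec, H.symm_apply_apply])
    right_inv := fun x => coe_injective (by
      rw [(h1 _).choose_spec, (h2 x).choose_spec, H.apply_symm_apply])
    continuous_toFun := by
      rw [isOpenEmbedding_coe.isInducing.continuous_iff]
      have : ((↑) : X → OnePoint X) ∘ (fun x => (h1 x).choose) = fun x : X => H (x : OnePoint X) :=
        funext fun x => (h1 x).choose_spec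
      rw [this]; exact H.continuous.comp continuous_coe
    continuous_invFun := by
      rw [isOpenEmbedding_coe.isInducing.continuous_iff]
      have : ((↑) : X → OnePoint X) ∘ (fun x => (h2 x).choose) =
          fun x : X => H.symm (x : OnePoint X) :=
        funext fun x => (h2 x).choose_spec
      rw [this]; exact H.symm.continuous.comp continuous_coe }

/-- The restriction is the given homeomorphism on finite points. [folklore] -/
@[simp]
theorem coe_onePointRestrict_apply (H : OnePoint X ≃ₜ OnePoint X) (hH : H ∞ = ∞) (x : X) :
    ((H.onePointRestrict hH x : X) : OnePoint X) = H x :=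
  (ne_infty_iff_exists.1 (H.onePoint_apply_coe_ne_infty hH x)).choose_spec

end Homeomorph

namespace Literature.Topology.FourManifolds

/-! ### §2 Generalities: singular sets under conjugation and one-point extension -/

section General

variable {X Y Z W : Type*}

/-- Post-composition with an injective map transports the singular set. [folklore] -/
theorem singularSet_comp_of_injective {f : X → Y} {e : Y → Z} (he : Injective e) :
    singularSet (e ∘ f) = e '' singularSet f := by
  ext z
  constructor
  · rintro ⟨a, ha, b, hb, hab⟩
    rw [mem_preimage, mem_singleton_iff, comp_apply] at ha hb
    exact ⟨f a, ⟨a, rfl, b, he (hb.trans ha.symm), hab⟩, ha⟩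
  · rintro ⟨y, ⟨a, ha, b, hb, hab⟩, rfl⟩
    rw [mem_preimage, mem_singleton_iff] at ha hb
    exact ⟨a, by simp [ha], b, by simp [hb], hab⟩

/-- Pre-composition with a bijection does not change the singular set. [folklore] -/
theorem singularSet_comp_of_bijective {φ : W → X} (hφ : Bijective φ) (f : X → Y) :
    singularSet (f ∘ φ) = singularSet f := by
  ext y
  constructor
  · rintro ⟨a, ha, b, hb, hab⟩
    exact ⟨φ a, ha, φ b, hb, fun h => hab (hφ.1 h)⟩
  · rintro ⟨a, ha, b, hb, hab⟩
    obtain ⟨a', rfl⟩ := hφ.2 a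
    obtain ⟨b', rfl⟩ := hφ.2 b
    exact ⟨a', ha, b', hb, fun h => hab (congrArg φ h)⟩

/-- **The singular set of the one-point extension** of a self-map is the image of the singular
set: the fibre of `∞` is `{∞}`. [cite: FreedmanJDG1982, proof of Thm. 1.1 (p. 412)] -/
theorem singularSet_onePointMap (β : X → Y) :
    singularSet (OnePoint.map β) = ((↑) : Y → OnePoint Y) '' singularSet β := by
  ext z
  constructor
  · rintro ⟨a, ha, b, hb, hab⟩
    rw [mem_preimage, mem_singleton_iff] at ha hb
    induction a using OnePoint.rec with
    | infty =>
      rw [OnePoint.map_infty] at ha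
      induction b using OnePoint.rec with
      | infty => exact absurd rfl hab
      | coe b => rw [← ha, OnePoint.map_some] at hb; exact absurd hb (OnePoint.coe_ne_infty _)
    | coe a =>
      induction b using OnePoint.rec with
      | infty =>
        rw [OnePoint.map_infty] at hb
        rw [← hb, OnePoint.map_some] at ha; exact absurd ha (OnePoint.coe_ne_infty _)
      | coe b =>
        rw [OnePoint.map_some] at ha hb
        refine ⟨β a, ⟨a, rfl, b, OnePoint.coe_injective (hb.trans ha.symm), fun h => hab ?_⟩, ha⟩
        rw [h]
  · rintro ⟨y, ⟨a, ha, b, hb, hab⟩, rfl⟩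
    rw [mem_preimage, mem_singleton_iff] at ha hb
    refine ⟨a, ?_, b, ?_, fun h => hab (OnePoint.coe_injective h)⟩
    · rw [mem_preimage, mem_singleton_iff, OnePoint.map_some, ha]
    · rw [mem_preimage, mem_singleton_iff, OnePoint.map_some, hb]

/-- The fibre of the one-point extension over a finite point. [folklore] -/
theorem preimage_onePointMap_coe (β : X → Y) (y : Y) :
    OnePoint.map β ⁻¹' {(y : OnePoint Y)} = ((↑) : X → OnePoint X) '' (β ⁻¹' {y}) := by
  ext a
  induction a using OnePoint.rec with
  | infty =>
    simp only [mem_preimage, OnePoint.map_infty, mem_singleton_iff, mem_image]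
    exact ⟨fun h => absurd h (OnePoint.infty_ne_coe _), fun ⟨x, _, hx⟩ =>
      absurd hx (OnePoint.coe_ne_infty _)⟩
  | coe a =>
    simp only [mem_preimage, OnePoint.map_some, mem_singleton_iff, OnePoint.coe_eq_coe, mem_image]
    constructor
    · exact fun h => ⟨a, h, rfl⟩
    · rintro ⟨x, hx, rfl⟩; exact hx

/-- The fibre of the one-point extension over `∞` is `{∞}`. [folklore] -/
theorem preimage_onePointMap_infty (β : X → Y) :
    OnePoint.map β ⁻¹' {(∞ : OnePoint Y)} = {∞} := by
  ext a
  induction a using OnePoint.rec with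
  | infty => simp
  | coe a =>
    simp only [mem_preimage, OnePoint.map_some, mem_singleton_iff]
    exact ⟨fun h => absurd h (OnePoint.coe_ne_infty _), fun h => absurd h (OnePoint.coe_ne_infty _)⟩

/-- The one-point extension of a surjection is a surjection. [folklore] -/
theorem surjective_onePointMap {β : X → Y} (hβ : Surjective β) : Surjective (OnePoint.map β) := by
  intro z
  induction z using OnePoint.rec with
  | infty => exact ⟨∞, rfl⟩
  | coe y => obtain ⟨x, rfl⟩ := hβ y; exact ⟨x, rfl⟩

/-- In `OnePoint X`, `s ∪ {∞}` is the complement of (the image of) `sᶜ`. [folklore] -/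
theorem image_coe_union_infty [TopologicalSpace X] (s : Set X) :
    ((↑) : X → OnePoint X) '' s ∪ {∞} = (((↑) : X → OnePoint X) '' sᶜ)ᶜ := by
  ext z
  induction z using OnePoint.rec with
  | infty =>
    simp only [mem_union, mem_singleton_iff, or_true, mem_compl_iff, true_iff]
    exact OnePoint.infty_notMem_image_coe
  | coe x =>
    constructor
    · rintro (⟨y, hy, hyx⟩ | hx)
      · rw [OnePoint.coe_eq_coe] at hyx
        subst hyx
        rintro ⟨z, hz, hzx⟩
        rw [OnePoint.coe_eq_coe] at hzx
        subst hzx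
        exact hz hy
      · exact absurd (mem_singleton_iff.1 hx) (OnePoint.coe_ne_infty x)
    · intro hx
      refine Or.inl ⟨x, ?_, rfl⟩
      by_contra hxs
      exact hx ⟨x, hxs, rfl⟩

end General

/-! ### §3 The theorem -/

section Euclidean

variable {n : ℕ}

/-- Local notation: `𝔼 n` is the model Euclidean space `EuclideanSpace ℝ (Fin n)`. -/
local notation "𝔼 " n:arg => EuclideanSpace ℝ (Fin n)

set_option quotPrecheck false in
/-- Local notation: `𝕊 n` is the unit sphere in `EuclideanSpace ℝ (Fin (n + 1))`. -/
local notation "𝕊 " n:arg => ↥(Metric.sphere (0 : EuclideanSpace ℝ (Fin (n + 1))) 1)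

/-- **Freedman's approximation theorem for proper self-maps of `ℝⁿ`, relative form, with
closeness over a compact set of values.**  Let `β : ℝⁿ → ℝⁿ` (`n ≥ 2`) be a proper surjection
whose singular set `S(β)` is nowhere dense and whose point inverses form a null collection, let
`C ⊆ ℝⁿ` be a closed set of values missing `S(β)` (so `β` is one-to-one over `C`), `Q ⊆ ℝⁿ` a
compact set of values and `ε > 0`.  Then there is a self-homeomorphism `h` of `ℝⁿ` with
`h = β` on `β⁻¹C` and `dist (h x) (β x) < ε` whenever `β x ∈ Q`.  (The one-point extension of
`β` to `Sⁿ = ℝⁿ ∪ ∞` satisfies the hypotheses of the relative sphere-to-sphere theorem with the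
closed set `C ∪ {∞}`; the resulting homeomorphism of `Sⁿ` fixes `∞` and is removed from it.)
[cite: FreedmanJDG1982, proof of Thm. 1.1 (pp. 412–413), Thm. 9.1, footnote 13, Cor. 7.1] -/
theorem exists_homeomorph_eqOn_dist_lt_of_isProperMap (hn : 2 ≤ n) {β : 𝔼 n → 𝔼 n}
    (hβ : IsProperMap β) (hsurj : Surjective β) (hnd : IsNowhereDense (singularSet β))
    (hnull : HasNullFibres β) {C : Set (𝔼 n)} (hC : IsClosed C)
    (hCβ : Disjoint (singularSet β) C) {Q : Set (𝔼 n)} (hQ : IsCompact Q) {ε : ℝ} (hε : 0 < ε) :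
    ∃ h : (𝔼 n) ≃ₜ (𝔼 n), EqOn h β (β ⁻¹' C) ∧ ∀ x, β x ∈ Q → dist (h x) (β x) < ε := by
  haveI : Fact (Module.finrank ℝ (𝔼 (n + 1)) = n + 1) := ⟨by simp⟩
  -- the one-point compactification, identified with the round sphere
  set Φ : OnePoint (𝔼 n) ≃ₜ 𝕊 n := onePointEquivSphereOfFinrankEq (by simp) with hΦ
  set ι : 𝔼 n → 𝕊 n := fun x => Φ (x : OnePoint (𝔼 n)) with hι
  have hιc : Continuous ι := Φ.continuous.comp OnePoint.continuous_coe
  have hιi : Injective ι := Φ.injective.comp OnePoint.coe_injective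
  have hιemb : Topology.IsOpenEmbedding ι := Φ.isOpenEmbedding.comp OnePoint.isOpenEmbedding_coe
  have hιinf : ∀ x, ι x ≠ Φ ∞ := fun x h => OnePoint.coe_ne_infty x (Φ.injective h)
  -- `ι` is uniformly continuous: it tends to `Φ ∞` at infinity
  have hιt : Tendsto ι (cocompact (𝔼 n)) (𝓝 (Φ ∞)) := by
    have h1 : Tendsto ((↑) : 𝔼 n → OnePoint (𝔼 n)) (cocompact (𝔼 n)) (𝓝 ∞) := by
      rw [← coclosedCompact_eq_cocompact]; exact OnePoint.tendsto_coe_infty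
    exact (Φ.continuous.tendsto ∞).comp h1
  have hιu : UniformContinuous ι := hιc.uniformContinuous_of_tendsto_cocompact hιt
  -- the extension `f = Φ ∘ β⁺ ∘ Φ⁻¹` of `β` to the sphere
  have hβc : Continuous β := hβ.continuous
  have hβt : Tendsto β (cocompact (𝔼 n)) (cocompact (𝔼 n)) :=
    (isProperMap_iff_tendsto_cocompact.1 hβ).2
  set F : OnePoint (𝔼 n) → OnePoint (𝔼 n) := OnePoint.map β with hF
  have hFc : Continuous F :=
    OnePoint.continuous_map hβc (by simpa only [coclosedCompact_eq_cocompact] using hβt)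
  set f : 𝕊 n → 𝕊 n := Φ ∘ F ∘ Φ.symm with hf
  have hfc : Continuous f := Φ.continuous.comp (hFc.comp Φ.symm.continuous)
  have hfsurj : Surjective f :=
    Φ.surjective.comp ((surjective_onePointMap hsurj).comp Φ.symm.surjective)
  have hfι : ∀ x, f (ι x) = ι (β x) := fun x => by
    simp only [hf, hι, comp_apply, Homeomorph.symm_apply_apply, hF, OnePoint.map_some]
  have hfinf : f (Φ ∞) = Φ ∞ := by
    simp only [hf, comp_apply, Homeomorph.symm_apply_apply, hF, OnePoint.map_infty]
  -- its singular set is `ι(S(β))`, nowhere dense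
  have hSf : singularSet f = ι '' singularSet β := by
    rw [hf, ← comp_assoc, singularSet_comp_of_bijective Φ.symm.bijective,
      singularSet_comp_of_injective Φ.injective, hF, singularSet_onePointMap, image_image]
  have hfnd : IsNowhereDense (singularSet f) := by
    rw [hSf]; exact hιemb.isInducing.isNowhereDense_image hnd
  -- its fibres: `{Φ ∞}` over `Φ ∞`, `ι(β⁻¹ y)` over `ι y`
  have hfib : ∀ y, f ⁻¹' {ι y} = ι '' (β ⁻¹' {y}) := fun y => by
    ext w
    constructor
    · intro hw
      rw [mem_preimage, mem_singleton_iff] at hw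
      obtain ⟨z, rfl⟩ := Φ.surjective w
      have h1 : F z = (y : OnePoint (𝔼 n)) := Φ.injective (by
        rw [hf] at hw; simpa only [comp_apply, Homeomorph.symm_apply_apply] using hw)
      have h2 : z ∈ OnePoint.map β ⁻¹' {(y : OnePoint (𝔼 n))} := h1
      rw [preimage_onePointMap_coe] at h2
      obtain ⟨x, hx, rfl⟩ := h2
      exact ⟨x, hx, rfl⟩
    · rintro ⟨x, hx, rfl⟩
      rw [mem_preimage, mem_singleton_iff] at hx
      rw [mem_preimage, mem_singleton_iff, hfι, hx]
  have hfibinf : f ⁻¹' {Φ ∞} = {Φ ∞} := by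
    ext w
    constructor
    · intro hw
      rw [mem_preimage, mem_singleton_iff] at hw
      obtain ⟨z, rfl⟩ := Φ.surjective w
      have h1 : F z = ∞ := Φ.injective (by
        rw [hf] at hw; simpa only [comp_apply, Homeomorph.symm_apply_apply] using hw)
      have h2 : z ∈ OnePoint.map β ⁻¹' {∞} := h1
      rw [preimage_onePointMap_infty] at h2
      rw [mem_singleton_iff.1 h2]; rfl
    · intro hw
      rw [mem_singleton_iff.1 hw]
      exact hfinf
  -- null fibres, for the metric of the sphere
  have hfnull : HasNullFibres f := by
    refine hasNullFibres_of_finite_le_diam (fun w => isBounded_of_compactSpace) fun δ hδ => ?_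
    obtain ⟨η, hη, hη'⟩ := Metric.uniformContinuous_iff.1 hιu (δ / 2) (half_pos hδ)
    refine ((hnull (ENNReal.ofReal η) (ENNReal.ofReal_pos.2 hη)).image ι).subset fun w hw => ?_
    rw [mem_setOf_eq] at hw
    -- `w = ι y` for some `y` (the fibre of `Φ ∞` is a point)
    obtain ⟨z, rfl⟩ := Φ.surjective w
    induction z using OnePoint.rec with
    | infty => rw [hfibinf, diam_singleton] at hw; exact absurd hw (not_le.2 hδ)
    | coe y =>
      refine ⟨y, ?_, rfl⟩
      rw [mem_setOf_eq]
      by_contra hlt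
      rw [not_le] at hlt
      have hsmall : diam (f ⁻¹' {ι y}) ≤ δ / 2 := by
        rw [hfib]
        refine diam_le_of_forall_dist_le (half_pos hδ).le ?_
        rintro _ ⟨a, ha, rfl⟩ _ ⟨b, hb, rfl⟩
        refine (hη' ?_).le
        have : edist a b < ENNReal.ofReal η := (Metric.edist_le_ediam_of_mem ha hb).trans_lt hlt
        rwa [edist_dist, ENNReal.ofReal_lt_ofReal_iff hη] at this
      exact absurd (hw.trans hsmall) (by linarith)
  -- the closed set `L = ι(C) ∪ {Φ ∞}`, missing `S(f)`
  set L : Set (𝕊 n) := ι '' C ∪ {Φ ∞} with hL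
  have hLc : IsClosed L := by
    have h1 : L = Φ '' (((↑) : 𝔼 n → OnePoint (𝔼 n)) '' C ∪ {∞}) := by
      rw [image_union, image_singleton, image_image]
    rw [h1, image_coe_union_infty, Φ.isClosed_image, isClosed_compl_iff, OnePoint.isOpen_image_coe]
    exact hC.isOpen_compl
  have hLS : Disjoint (singularSet f) L := by
    rw [hSf, hL, disjoint_union_right]
    refine ⟨?_, disjoint_singleton_right.2 ?_⟩
    · rw [disjoint_image_iff hιi]; exact hCβ
    · rintro ⟨x, -, hx⟩; exact hιinf x hx
  -- closeness over `Q`: choose the sphere-scale `δ`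
  obtain ⟨R, hQR⟩ := hQ.isBounded.subset_closedBall 0
  set Q₂ : Set (𝔼 n) := closedBall 0 (R + ε) with hQ₂
  have hQ₂c : IsCompact Q₂ := isCompact_closedBall _ _
  -- `ι(Q)` and `ι(ℝⁿ ∖ int Q₂) ∪ {Φ ∞}` are disjoint compacta
  have hKc : IsCompact (ι '' (ball (0 : 𝔼 n) (R + ε))ᶜ ∪ {Φ ∞}) := by
    refine IsClosed.isCompact ?_
    have h1 : ι '' (ball (0 : 𝔼 n) (R + ε))ᶜ ∪ {Φ ∞} =
        Φ '' (((↑) : 𝔼 n → OnePoint (𝔼 n)) '' (ball (0 : 𝔼 n) (R + ε))ᶜ ∪ {∞}) := by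
      rw [image_union, image_singleton, image_image]
    rw [h1, image_coe_union_infty, compl_compl, Φ.isClosed_image, isClosed_compl_iff,
      OnePoint.isOpen_image_coe]
    exact isOpen_ball
  have hdisj : Disjoint (ι '' Q) (ι '' (ball (0 : 𝔼 n) (R + ε))ᶜ ∪ {Φ ∞}) := by
    rw [disjoint_union_right, disjoint_image_iff hιi]
    refine ⟨disjoint_compl_right_iff_subset.2 (hQR.trans (closedBall_subset_ball (by linarith))),
      disjoint_singleton_right.2 ?_⟩
    rintro ⟨x, -, hx⟩; exact hιinf x hx
  obtain ⟨θ, hθ, hθd⟩ := hdisj.exists_thickenings (hQ.image hιc) hKc.isClosed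
  have hθ' : ∀ a ∈ ι '' Q, ∀ b ∈ ι '' (ball (0 : 𝔼 n) (R + ε))ᶜ ∪ {Φ ∞}, θ ≤ dist a b := by
    intro a ha b hb
    by_contra hlt
    rw [not_le] at hlt
    refine hθd.le_bot ⟨mem_thickening_iff.2 ⟨a, ha, by rwa [dist_comm]⟩,
      mem_thickening_iff.2 ⟨b, hb, by rw [dist_self]; exact hθ⟩⟩
  -- uniform continuity of `ι⁻¹` on the compact `ι(Q₂)`
  obtain ⟨θ₁, hθ₁, hθ₁'⟩ : ∃ θ₁ > 0, ∀ a ∈ Q₂, ∀ b ∈ Q₂, dist (ι a) (ι b) < θ₁ → dist a b < ε := by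
    have hcont : ContinuousOn (invFunOn ι Q₂) (ι '' Q₂) :=
      continuousOn_invFunOn_image_of_isCompact hQ₂c hιc.continuousOn hιi.injOn
    obtain ⟨θ₁, hθ₁, h⟩ := Metric.uniformContinuousOn_iff.1
      ((hQ₂c.image hιc).uniformContinuousOn_of_continuous hcont) ε hε
    refine ⟨θ₁, hθ₁, fun a ha b hb hab => ?_⟩
    have := h (ι a) (mem_image_of_mem ι ha) (ι b) (mem_image_of_mem ι hb) hab
    rwa [hιi.injOn.leftInvOn_invFunOn ha, hιi.injOn.leftInvOn_invFunOn hb] at this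
  -- the relative sphere-to-sphere theorem
  obtain ⟨g, hgdist, hgL⟩ :=
    IsTopSphere.exists_homeomorph_dist_lt_eqOn_of_isNowhereDense_of_hasNullFibres
      (isTopSphere_sphere (E := 𝔼 (n + 1))) hn hfc hfsurj hfnd hfnull hLc hLS (lt_min hθ hθ₁)
  -- `g` fixes `Φ ∞`; remove the point at infinity
  set G : OnePoint (𝔼 n) ≃ₜ OnePoint (𝔼 n) := (Φ.trans g).trans Φ.symm with hG
  have hGinf : G ∞ = ∞ := by
    have : g (Φ ∞) = f (Φ ∞) := hgL (show f (Φ ∞) ∈ L by rw [hfinf]; exact Or.inr rfl)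
    simp only [hG, Homeomorph.trans_apply, this, hfinf, Homeomorph.symm_apply_apply]
  set h := G.onePointRestrict hGinf with hh
  have hGι : ∀ x : 𝔼 n, Φ (G (x : OnePoint (𝔼 n))) = g (ι x) := fun x => by
    simp only [hG, Homeomorph.trans_apply, Homeomorph.apply_symm_apply, hι]
  have hhι : ∀ x : 𝔼 n, ι (h x) = g (ι x) := fun x => by
    rw [← hGι]
    show Φ ((h x : 𝔼 n) : OnePoint (𝔼 n)) = Φ (G x)
    rw [hh, Homeomorph.coe_onePointRestrict_apply]
  refine ⟨h, fun x hx => hιi ?_, fun x hx => ?_⟩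
  · -- agreement over `C`
    rw [hhι, ← hfι]
    exact hgL (show f (ι x) ∈ L by rw [hfι]; exact Or.inl (mem_image_of_mem ι hx))
  · -- closeness over `Q`
    have h1 : dist (ι (h x)) (ι (β x)) < min θ θ₁ := by rw [hhι, ← hfι]; exact hgdist (ι x)
    have hβx : β x ∈ Q₂ := (hQR.trans (closedBall_subset_closedBall (by linarith))) hx
    have hhx : h x ∈ Q₂ := by
      by_contra hout
      have hmem : ι (h x) ∈ ι '' (ball (0 : 𝔼 n) (R + ε))ᶜ ∪ {Φ ∞} :=
        Or.inl (mem_image_of_mem ι fun hb => hout (ball_subset_closedBall hb))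
      have := hθ' (ι (β x)) (mem_image_of_mem ι hx) _ hmem
      rw [dist_comm] at this
      exact absurd (this.trans_lt (h1.trans_le (min_le_left _ _))) (lt_irrefl _)
    exact hθ₁' (h x) hhx (β x) hβx (h1.trans_le (min_le_right _ _))

/-- **Freedman's approximation theorem for proper self-maps of `ℝⁿ`, relative form** (the last
step of the proof of Thm. 1.1): a proper surjective self-map `β` of `ℝⁿ` (`n ≥ 2`) with nowhere
dense singular set and null point inverses agrees with some self-homeomorphism of `ℝⁿ` on `β⁻¹C`,
for every closed set of values `C` missing the singular set (*"a homeomorphism `h : S⁴ → S⁴`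
with `h|_C = f|_C`. In particular `h(∞) = ∞`. Now remove the compactification point `∞`"*).
[cite: FreedmanJDG1982, proof of Thm. 1.1 (pp. 412–413), Thm. 9.1, footnote 13, Cor. 7.1] -/
theorem exists_homeomorph_eqOn_of_isProperMap (hn : 2 ≤ n) {β : 𝔼 n → 𝔼 n}
    (hβ : IsProperMap β) (hsurj : Surjective β) (hnd : IsNowhereDense (singularSet β))
    (hnull : HasNullFibres β) {C : Set (𝔼 n)} (hC : IsClosed C)
    (hCβ : Disjoint (singularSet β) C) :
    ∃ h : (𝔼 n) ≃ₜ (𝔼 n), EqOn h β (β ⁻¹' C) := by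
  obtain ⟨h, hh, -⟩ := exists_homeomorph_eqOn_dist_lt_of_isProperMap hn hβ hsurj hnd hnull hC hCβ
    isCompact_empty one_pos
  exact ⟨h, hh⟩

end Euclidean

end Literature.Topology.FourManifolds

end
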